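import Mathlib.Analysis.SpecialFunctions.Pow.Real
import Mathlib.Analysis.Complex.AbsMax
import Mathlib.Analysis.Normed.Module.RCLike.Real
import Mathlib.Algebra.Polynomial.Eval.Defs
import Mathlib.LinearAlgebra.Matrix.Determinant.Basic
import Mathlib.Analysis.Complex.Polynomial.Basic
import HarnessLib

/-!
# Roy's small value estimate for `𝔾ₐ × 𝔾ₘ` — three elementary devices of §§6–7

Topic `Literature/NumberTheory/Transcendental`. Part of the formalisation of the proof of Roy 2013,
Theorem 1.1 (named fact `roy2013_thm_1_1`, `RoySmallValueEstimates.lean`), seat B. Source: D. Roy,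
*A small value estimate for `𝔾ₐ × 𝔾ₘ`*, Mathematika 59 (2013) 333–363 = arXiv:1301.0663.

Three self-contained lemmas isolated from the geometry:

* `exists_component_forall_prod_le` — **the selection of a component** (proof of Prop. 6.2,
  p. 16: "From the last estimate and the additivity of the degree and heights on one-dimensional
  cycles, we deduce the existence of a component `Z₁` of `Z'` with
  `h_C(Z₁) ≤ -C'D(Dh(Z₁) + 3Y deg(Z₁))`", used twice there): in the abstract form in which this
  development consumes it — points `j ∈ J` grouped into components `comp j ∈ I` with exponents
  `e_i ≥ 1` and weights `w_i ≥ 0`, `∑ e_i w_i ≤ B`; if EVERY admissible test family `t` has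
  `∏_j v_j(t_j)^{e_{comp j}} ≤ ε` (`0 < ε < 1`), then SOME component `i` has
  `∏_{comp j = i} v_j(t_j) ≤ ε^{w_i / B}` for every admissible family (otherwise glue violating
  families component-wise);
* `norm_eval_one_le_of_X_pow_dvd` — **Schwarz's lemma for a polynomial** (proof of Prop. 6.1,
  p. 15: "`f(z)` vanishes to order at least `T` at `z = 0`. Applying the standard Schwarz lemma,
  this leads to `|f(1)| ≤ e^{-TU} sup{|f(z)| ; |z| = e^U}`"): if `X^T ∣ p` and `|p(z)| ≤ M` on
  `|z| = R ≥ 1` then `|p(1)| ≤ M / R^T` (maximum modulus principle for `p / X^T`);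
* `norm_det_le_of_forall_norm_le` — `|det A| ≤ n! Bⁿ` when all `|A_{ij}| ≤ B` (the crude size
  estimate used for `Res_D` on the unit ball, Lemma 2.1 of the paper, here for a determinant).

Everything is proved; no definitions, no named facts.

## References

* [Roy2013] D. Roy, *A small value estimate for 𝔾ₐ × 𝔾ₘ*, Mathematika 59 (2013), 333–363
  (arXiv:1301.0663), §6: proofs of Prop. 6.1 (Schwarz) and Prop. 6.2 (selection of a
  component); §2 Lemma 2.1 (size of the resultant on the unit ball).
-/

noncomputable section

open Finset

namespace Literature.NumberTheory.Transcendental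

namespace Roy2013

/-! ### Selection of a component -/

/-- **Selection of a component.** Points `j ∈ J` are grouped into components by `comp : J → I`;
each component carries an exponent `e_i ≥ 1` and a weight `w_i` with `∑ e_i w_i ≤ B` (`B > 0`);
tests `x : X` are admissible when `ok x`, and `v_j(x)` is the size of test `x` at the point `j`. If every admissible family `t` satisfies `∏_j v_j(t_j)^{e_{comp j}} ≤ ε` with
`0 < ε < 1`, then some component `i` satisfies `∏_{comp j = i} v_j(t_j) ≤ ε^{w_i/B}` for EVERY
admissible family `t`. [cite: Roy2013, §6, proof of Prop. 6.2 (selection of the components `Z₁`, `Z`)] -/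
theorem exists_component_forall_prod_le {J I X : Type*} [Fintype J] [Fintype I] [DecidableEq I]
    (comp : J → I) (e : I → ℕ) (he : ∀ i, 1 ≤ e i) (w : I → ℝ)
    (ok : X → Prop) (v : J → X → ℝ) {ε B : ℝ} (hε0 : 0 < ε) (hε1 : ε < 1)
    (hB : 0 < B) (hsum : ∑ i, (e i : ℝ) * w i ≤ B)
    (H : ∀ t : J → X, (∀ j, ok (t j)) → ∏ j, v j (t j) ^ e (comp j) ≤ ε) :
    ∃ i, ∀ t : J → X, (∀ j, comp j = i → ok (t j)) →
      ∏ j ∈ univ.filter (fun j => comp j = i), v j (t j) ≤ ε ^ (w i / B) := by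
  classical
  by_contra hcon
  push Not at hcon
  choose t hok hlt using hcon
  -- the glued family
  set T : J → X := fun j => t (comp j) j with hT
  have hTok : ∀ j, ok (T j) := fun j => hok (comp j) j rfl
  have hH := H T hTok
  -- `∏_j v_j(T_j)^{e} = ∏_i (∏_{comp j = i} v_j(t_i j))^{e_i}`
  have hsplit : ∏ j, v j (T j) ^ e (comp j) =
      ∏ i, (∏ j ∈ univ.filter (fun j => comp j = i), v j (t i j)) ^ e i := by
    rw [← Finset.prod_fiberwise univ comp (fun j => v j (T j) ^ e (comp j))]
    refine Finset.prod_congr rfl fun i _ => ?_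
    rw [← prod_pow]
    refine Finset.prod_congr rfl fun j hj => ?_
    have hji : comp j = i := (mem_filter.mp hj).2
    rw [hT]
    simp only [hji]
  -- lower bound of the right side: `> ∏_i (ε^{w_i/B})^{e_i} = ε^{∑ e_i w_i / B} ≥ ε`
  rcases isEmpty_or_nonempty I with hI | hI
  · -- no components: then `J` is empty and `H` reads `1 ≤ ε`
    have hJ : IsEmpty J := ⟨fun j => hI.elim (comp j)⟩
    have : ∏ j, v j (T j) ^ e (comp j) = 1 := by
      rw [Finset.univ_eq_empty, prod_empty]
    linarith
  have hlt' : ∏ i, (ε ^ (w i / B)) ^ e i <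
      ∏ i, (∏ j ∈ univ.filter (fun j => comp j = i), v j (t i j)) ^ e i :=
    prod_lt_prod_of_nonempty (fun i _ => pow_pos (Real.rpow_pos_of_pos hε0 _) _)
      (fun i _ => pow_lt_pow_left₀ (hlt i) (Real.rpow_nonneg hε0.le _)
        (Nat.one_le_iff_ne_zero.mp (he i)))
      univ_nonempty
  have hlow : ε ≤ ∏ i, (ε ^ (w i / B)) ^ e i := by
    have hexp : ∏ i, (ε ^ (w i / B)) ^ e i = ε ^ (∑ i, (e i : ℝ) * w i / B) := by
      rw [Real.rpow_sum_of_pos hε0]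
      refine Finset.prod_congr rfl fun i _ => ?_
      rw [← Real.rpow_natCast, ← Real.rpow_mul hε0.le]
      congr 1; ring
    rw [hexp]
    have h1 : ∑ i, (e i : ℝ) * w i / B ≤ 1 := by
      rw [← Finset.sum_div, div_le_one hB]; exact hsum
    calc ε = ε ^ (1 : ℝ) := (Real.rpow_one ε).symm
      _ ≤ ε ^ (∑ i, (e i : ℝ) * w i / B) := Real.rpow_le_rpow_of_exponent_ge hε0 hε1.le h1
  rw [hsplit] at hH
  linarith

/-! ### Schwarz's lemma for a polynomial -/

/-- **Schwarz's lemma for a polynomial vanishing to order `T` at `0`**: if `X^T ∣ p` and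
`|p(z)| ≤ M` for `|z| = R`, `R ≥ 1`, then `|p(1)| ≤ M / R^T` (maximum modulus principle for
`p / X^T` on the disc `|z| ≤ R`, which contains `1`). [cite: Roy2013, §6, proof of Prop. 6.1 ("Applying the standard Schwarz lemma")] -/
theorem norm_eval_one_le_of_X_pow_dvd {p : Polynomial ℂ} {T : ℕ} (hp : Polynomial.X ^ T ∣ p)
    {R M : ℝ} (hR : 1 ≤ R) (hM : ∀ z : ℂ, ‖z‖ = R → ‖p.eval z‖ ≤ M) :
    ‖p.eval 1‖ ≤ M / R ^ T := by
  obtain ⟨q, rfl⟩ := hp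
  have hR0 : 0 < R := lt_of_lt_of_le one_pos hR
  -- on the circle `|z| = R`, `|q(z)| = |p(z)| / R^T ≤ M / R^T`
  have hq : ∀ z ∈ frontier (Metric.ball (0 : ℂ) R), ‖q.eval z‖ ≤ M / R ^ T := by
    intro z hz
    rw [frontier_ball (0 : ℂ) hR0.ne', Metric.mem_sphere, dist_zero_right] at hz
    have h := hM z hz
    rw [Polynomial.eval_mul, Polynomial.eval_pow, Polynomial.eval_X, norm_mul, norm_pow, hz] at h
    rw [le_div_iff₀ (pow_pos hR0 _), mul_comm]
    exact h
  have h1 : (1 : ℂ) ∈ closure (Metric.ball (0 : ℂ) R) := by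
    rw [closure_ball (0 : ℂ) hR0.ne', Metric.mem_closedBall, dist_zero_right, norm_one]
    exact hR
  have hmax := Complex.norm_le_of_forall_mem_frontier_norm_le Metric.isBounded_ball
    (q.differentiable.diffContOnCl) hq h1
  simpa [Polynomial.eval_mul] using hmax

/-! ### Size of a determinant -/

/-- `|det A| ≤ n! Bⁿ` when all entries have `|A_{ij}| ≤ B`. [folklore] -/
theorem norm_det_le_of_forall_norm_le {n : Type*} [Fintype n] [DecidableEq n] (A : Matrix n n ℂ)
    {B : ℝ} (hB : ∀ i j, ‖A i j‖ ≤ B) :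
    ‖A.det‖ ≤ (Fintype.card n).factorial * B ^ Fintype.card n := by
  rw [Matrix.det_apply']
  refine (norm_sum_le _ _).trans ?_
  have hterm : ∀ σ : Equiv.Perm n,
      ‖((Equiv.Perm.sign σ : ℤ) : ℂ) * ∏ i, A (σ i) i‖ ≤ B ^ Fintype.card n := by
    intro σ
    have hsign : ‖((Equiv.Perm.sign σ : ℤ) : ℂ)‖ = 1 := by
      rcases Int.units_eq_one_or (Equiv.Perm.sign σ) with h | h <;> simp [h]
    rw [norm_mul, hsign, one_mul, norm_prod, ← Finset.card_univ, ← Finset.prod_const]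
    exact Finset.prod_le_prod (fun i _ => norm_nonneg _) fun i _ => hB _ _
  calc ∑ σ : Equiv.Perm n, ‖((Equiv.Perm.sign σ : ℤ) : ℂ) * ∏ i, A (σ i) i‖
      ≤ ∑ _σ : Equiv.Perm n, B ^ Fintype.card n := Finset.sum_le_sum fun σ _ => hterm σ
    _ = (Fintype.card n).factorial * B ^ Fintype.card n := by
        rw [Finset.sum_const, Finset.card_univ, Fintype.card_perm, nsmul_eq_mul]

end Roy2013

end Literature.NumberTheory.Transcendental
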